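import Summits.ABC.IUTFork.Joshi.ATS4GenuineResidualSUnitFibres
import Summits.ABC.IUTFork.Joshi.ATS4DescentSpineGenuineResidual
import Summits.ABC.IUTFork.Joshi.ATS4DescentSpineVolFreeResidualObstruction
import Summits.ABC.IUTFork.LDHSUnitFamilySzpiroGuard
import Literature.IUT.LogVolume.Corollary22FullGaloisImage
import Literature.IUT.LogVolume.Corollary22PrimeChoiceEffective
import HarnessLib

/-!
# [J-IV] (arXiv:2403.10430v2) §6.10–§7.1, E5 descent spine: the GENUINE-COMPONENT residual of `abc_of_genuineResidualSupport`
# is UNSATISFIABLE — a kernel countermodel on the S-unit points of the `λ`-line (R-J row Y-21 PARENT, «residualSupport_unsat»)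

Proof-only companion (0 defs) of the abc-iut cell, sub-cell R-J «JOSHI Y-DISCHARGE CENSUS» (rung LADDER-ABC:A2.RESCUE.J; table of record
`HOME/plan/E/R-J/Y-CENSUS.tsv`, row Y-21 PARENT), seat abc-iut-E-t35 (gen 9), the KERNEL HAND asked for by E-plan 21:34:34Z / 21:55:31Z /
22:07:05Z on E-cx-3 g3's located countermodel (memo `HOME/plan/E/cx-3/Y21-PARENT-READ.md` §C2–C3, sha16 46e1112be5e87740) in E-cx-2 g2's
WINDOW-FREE form (22:01:31Z): E-t33's `abc_of_genuineResidualSupport` (p464392 §4; `Joshi/ATS4DescentSpineGenuineResidual.lean`) derives `ABC`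
from a binder asking the supplier, at every admissible `(d, λ, ℓ)`, for local hull log-volumes satisfying [IUTchIV] Step (v) PER PRIME against
the GENUINE components of `log(d_{L′})`, `log(q)` ((R4′)) and the lower bound at `φ(y₀)` ((R5)). E-t50's `not_exists_volumes_of_localExcess`
(p470440) typed the mechanism: (6.11.1) sums ABSOLUTE VALUES ([J-III] §9.11.1 p.127 l.82–p.128 l.27, [J-IV] (6.11.1) p.69 l.73–p.70 l.3), so ONE
prime whose local `q`-excess beats `(1/2ℓ)·log 𝔮_F` kills (R4′) ∧ (R5) whatever happens elsewhere. THIS FILE supplies the genuine arithmetic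
and closes the hand:

* `SUnitResidual.localExcess_arith` — the real inequality at `p₀ = 5` for every `ℓ ≥ 7` once `a ≥ 10⁸` (failure ratio `ℓ(ℓ+1)/36`);
* **`SUnitResidual.genuineResidualSupport_unsat`** — at the tree's S-unit point `P_{a,c} = (ℚ(√(5^{2a}+4·7^{2c})), θ/7^c)` (abc-iut-s2-p4's
  `LDHSUnitFamily*.lean`; `a ≥ 10⁸`, `7^c ≤ 5^a`), `d = 2`, and EVERY prime `ℓ ≥ 7`, the `∃`-body of the binder (VERBATIM) is FALSE: `5 ∈ V^dst_ℚ`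
  is forced by the support clause, `q₅ = a·log 5`, `d₅ ≤ 2·log 5` on the whole division tower (companion `ATS4GenuineResidualSUnitFibres`:
  Dedekind–Hensel + the tree's tameness `ThetaTower.hKtame`; the supplier CANNOT inflate `F`, `K`, `L_mod`, `V`, `D_K` to absorb the excess —
  E-cx-3's question (c) answered NO in kernel), `log 𝔮_F ≤ a·log 5 + 2c·log 7 ≤ 3a·log 5`;
* **`not_genuineResidualSupport_antecedent`** — HENCE THE HYPOTHESIS OF `abc_of_genuineResidualSupport` IS FALSE (its statement negated
  verbatim; `abc_of_genuineResidualSupport h` is type-checked inside the proof): the binder's own conditions are MET at `(2, P_{a,c}, ℓ)` with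
  `ℓ` the prime Lemma 5.8.7 supplies (`exists_isLem587Prime`, `isXiPrm_million`), (P6) by the tree's PROVED (P4) ⟹ (P6) on `K_∞(7)`
  (`Cor22.condP6_of_seven_le`, `SUnitFamily.P_mem_cbTwoDiscs`), the room by `lem678Room_of_isLem587Prime`. So `abc_of_genuineResidualSupport`
  and `abc_of_genuineResidual_reading3` are VACUOUS implications; what [J-IV] §6 can hand over at our carriers is the GLOBAL inequality (G)
  only (E-t50's `abc_of_globalInequality_nonneg`, p469729; E-cx-3 §C1) — the census word «ON PAPER, kernel hand wanted» becomes «IN KERNEL».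

Witness choice (recorded): the row names `λ_N = 2·3^N/(3^N − 7)` at `p₀ = 3`, `d = 1`; the tree holds no pole bookkeeping for `λ_N` but
COMPLETE bookkeeping for the S-unit family (`badPlaces_eq`, `logQAvoid_le`, `P_mem_UP`, `condP2_P`/`condP5_P`, `P_mem_cbTwoDiscs`), so the same
mechanism is run at `p₀ = 5`, `d = 2` (`e_mod ≤ d_mod ≤ 2` doubles `e*_mod`; absorbed by `a ≥ 10⁸`). SOURCE locators: [J-IV] Prop. 6.10.9
p.69 l.1–28, (6.11.1) p.69 l.73–p.70 l.3, p.70 l.4–29, p.71 l.107–110, Lemma 5.8.7 p.56 l.33–44, Thm. 5.7.1 p.53 l.31–46 (render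
`HOME/lit/renders/Joshi-arxiv-2403.10430/`); [IUTchIV] Thm. 1.10 Step (v) p.27–28, Cor. 2.2 (ii) (P1)–(P7) pp.45–46 (kurims). FRAMING (binding):
a located COUNTERMODEL to the E5 residual AS PRINTED with (6.11.1)'s `Σ|·|` convention, at OUR typed carriers — not to any author's theorem;
NO side taken on [IUTchIII] Cor. 3.12 / [IUTchIV] Thm. 1.10, on Joshi's claims or on Mochizuki's report on them; NOT an abc claim (nothing
here proves or refutes abc); typed ≠ proved ≠ endorsed. Theorems only; standard axioms; FACT rows none. [claim: Joshi2024ATS4, status: disputed].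
-/

noncomputable section

namespace Summit.ABC.IUTFork.Joshi.ATS4

open NumberField IsDedekindDomain Finset
open Literature.IUT.LogVolume Literature.IUT.LogVolume.Cor22
open Literature.NumberTheory.DiophantineGeometry Literature.NumberTheory.DiophantineGeometry.GenEll
open Literature.NumberTheory.EllipticCurves
open Summit.ABC.IUTFork.SUnitFamily
open scoped Classical

namespace SUnitResidual

/-! ## 1. The real arithmetic of the local excess at `p₀ = 5` -/

/-- **The local excess at `5` beats the global cap, for every `ℓ ≥ 7`** (pure real arithmetic): with `Q ≤ 3a·log 5` (total `log 𝔮_F`),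
`q ≥ a·log 5` (the `5`-component of `log q`), `d ≤ 2·log 5` (the `5`-component of `log 𝔡_K`), `E ≤ 1105920 = 2·2¹²3³5` (`e*_mod` at
`e_mod ≤ d_mod ≤ 2`) and `0 ≤ ι ≤ (log 5)/5` (the Mertens weight), and `a ≥ 10⁸`:
`(1/2ℓ)·Q < ((ℓ+1)/4)·(q/6 − (1+4/ℓ)·d − (4/ℓ)·log 5 − (20/3)·E·ι)` — after dividing by `log 5 > 0` this is
`18a < ℓ(ℓ+1)(a/2 − 4423686) − 36(ℓ+1)`, increasing in `ℓ`, true at `ℓ = 7` once `a > 24 772 670`. (E-cx-2's window-free form: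
failure ratio `→ ℓ(ℓ+1)/36` of the `q₅`-share `1/3`.) [folklore] -/
theorem localExcess_arith {ℓ a Q q d E ι : ℝ} (hℓ : 7 ≤ ℓ) (ha : 10 ^ 8 ≤ a) (hQ : Q ≤ 3 * a * Real.log 5)
    (hq : a * Real.log 5 ≤ q) (hd : d ≤ 2 * Real.log 5) (hE : E ≤ 1105920) (hι0 : 0 ≤ ι)
    (hι : ι ≤ Real.log 5 / 5) :
    1 / (2 * ℓ) * Q < (ℓ + 1) / 4 * (1 / 6 * q - (1 + 4 / ℓ) * d - 4 / ℓ * Real.log 5 - 20 / 3 * E * ι) := by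
  have hL : 0 < Real.log 5 := Real.log_pos (by norm_num)
  have hℓ0 : 0 < ℓ := by linarith
  -- the polynomial core: `18a < ℓ(ℓ+1)(a/2 − 4423686) − 36(ℓ+1)`
  have hA : 0 ≤ a / 2 - 4423686 := by linarith
  have h1 : 7 * (a / 2 - 4423686) - 36 ≤ ℓ * (a / 2 - 4423686) - 36 := by nlinarith
  have h1' : 0 ≤ 7 * (a / 2 - 4423686) - 36 := by linarith
  have h2 : 8 * (7 * (a / 2 - 4423686) - 36) ≤ (ℓ + 1) * (ℓ * (a / 2 - 4423686) - 36) := by nlinarith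
  have key : 18 * a < ℓ * (ℓ + 1) * (a / 2 - 4423686) - 36 * (ℓ + 1) := by nlinarith
  -- divide by `12ℓ`
  have hred : 3 * a / (2 * ℓ) < (ℓ + 1) / 4 * (a / 6 - 2 - 12 / ℓ - 1474560) := by
    have e1 : 3 * a / (2 * ℓ) = 18 * a / (12 * ℓ) := by field_simp; ring
    have e2 : (ℓ + 1) / 4 * (a / 6 - 2 - 12 / ℓ - 1474560) = (ℓ * (ℓ + 1) * (a / 2 - 4423686) - 36 * (ℓ + 1)) / (12 * ℓ) := by
      field_simp; ring
    rw [e1, e2]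
    exact div_lt_div_of_pos_right key (by positivity)
  -- multiply by `log 5` and compare with the two sides
  have hlhs : 1 / (2 * ℓ) * Q ≤ Real.log 5 * (3 * a / (2 * ℓ)) := by
    have : 1 / (2 * ℓ) * Q ≤ 1 / (2 * ℓ) * (3 * a * Real.log 5) := mul_le_mul_of_nonneg_left hQ (by positivity)
    calc 1 / (2 * ℓ) * Q ≤ 1 / (2 * ℓ) * (3 * a * Real.log 5) := this
      _ = Real.log 5 * (3 * a / (2 * ℓ)) := by field_simp
  have hEι : E * ι ≤ 1105920 * (Real.log 5 / 5) := mul_le_mul hE hι hι0 (by norm_num)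
  have hcoef : 0 ≤ 1 + 4 / ℓ := by positivity
  have hdd : (1 + 4 / ℓ) * d ≤ (1 + 4 / ℓ) * (2 * Real.log 5) := mul_le_mul_of_nonneg_left hd hcoef
  have hrhs : Real.log 5 * ((ℓ + 1) / 4 * (a / 6 - 2 - 12 / ℓ - 1474560)) ≤
      (ℓ + 1) / 4 * (1 / 6 * q - (1 + 4 / ℓ) * d - 4 / ℓ * Real.log 5 - 20 / 3 * E * ι) := by
    have hin : Real.log 5 * (a / 6 - 2 - 12 / ℓ - 1474560) ≤
        1 / 6 * q - (1 + 4 / ℓ) * d - 4 / ℓ * Real.log 5 - 20 / 3 * E * ι := by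
      have e3 : Real.log 5 * (a / 6 - 2 - 12 / ℓ - 1474560) =
          1 / 6 * (a * Real.log 5) - (1 + 4 / ℓ) * (2 * Real.log 5) - 4 / ℓ * Real.log 5
            - 20 / 3 * (1105920 * (Real.log 5 / 5)) := by
        field_simp; ring
      rw [e3]; linarith
    have hc4 : 0 ≤ (ℓ + 1) / 4 := by positivity
    calc Real.log 5 * ((ℓ + 1) / 4 * (a / 6 - 2 - 12 / ℓ - 1474560))
        = (ℓ + 1) / 4 * (Real.log 5 * (a / 6 - 2 - 12 / ℓ - 1474560)) := by ring
      _ ≤ (ℓ + 1) / 4 * (1 / 6 * q - (1 + 4 / ℓ) * d - 4 / ℓ * Real.log 5 - 20 / 3 * E * ι) :=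
          mul_le_mul_of_nonneg_left hin hc4
  exact lt_of_le_of_lt hlhs (lt_of_lt_of_le (mul_lt_mul_of_pos_left hred hL) hrhs)

/-! ## 2. THE COUNTERMODEL: the genuine-component residual is unsatisfiable at `P_{a,c}`, `d = 2`, every prime `ℓ ≥ 7` -/

/-- **The GENUINE-COMPONENT residual (R4′) ∧ (R5) of `abc_of_genuineResidualSupport` (p464392 §4) is UNSATISFIABLE at the S-unit point
`P_{a,c}` (`a ≥ 10⁸`, `c ≥ 1`, `7^c ≤ 5^a`), `d = 2`, for EVERY prime `ℓ ≥ 7` (window-free).** The body below is that theorem's `∃`-body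
VERBATIM at `d := 2`, `P := Pt a c`. Whatever theta field `F`, division tower `K ⊆ F(E_F[ℓ])`, `L_mod` (`e_mod ≤ d_mod ≤ 2`), `V^dst_ℚ`
(forced to contain `5`: `exists_mem_V_residueChar_eq_five`), bookkeeping `D_K`, and local hull log-volumes the supplier returns: at `p₀ = 5`
the genuine components are `q₅ = a·log 5` (`qFive_eq`) and `d₅ ≤ 2·log 5` (`dFive_le`), `log 𝔮_F = log q^{∤{2,ℓ}}(λ_{a,c}) ≤ a·log 5 +
2c·log 7 ≤ 3a·log 5` (Prop. 4.4.4 `logq_ofNFPointOver_eq_logQAvoid`, `SUnitFamily.logQAvoid_le`), so the local excess beats the global cap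
(`localExcess_arith`) and E-t50's `not_exists_volumes_of_localExcess` (p470440: (6.11.1) sums `|vol_p|`, no other prime absorbs it) leaves
NO `(vol, vol_∞)`. E-cx-3's located countermodel (memo `Y21-PARENT-READ.md` §C2–C3, there on `λ_N` at `p₀ = 3`; here on the tree's S-unit
family at `p₀ = 5`, same mechanism) IN KERNEL. A located COUNTERMODEL to the E5 residual AS PRINTED with (6.11.1)'s `Σ|·|` convention —
not to any author's theorem; NO side taken on [IUTchIII] Cor. 3.12 / [IUTchIV] Thm. 1.10; NOT an abc claim. [claim: Joshi2024ATS4, status: disputed] -/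
theorem genuineResidualSupport_unsat {a c : ℕ} (ha : 10 ^ 8 ≤ a) (hc : 1 ≤ c) (hlo : 7 ^ c ≤ 5 ^ a) {ℓ : ℕ}
    (hℓ : ℓ.Prime) (h7 : 7 ≤ ℓ) :
    ¬ ∃ (F : Type) (_ : Field F) (_ : NumberField F) (_ : Algebra (Pt a c).F F)
          (K : Type) (_ : Field K) (_ : NumberField K) (_ : Algebra F K) (_ : Algebra (Pt a c).F K)
          (_ : IsScalarTower (Pt a c).F F K)
          (_ : IsGalois F K) (ψ : K →ₐ[F] AlgebraicClosure F) (hU : (Pt a c).InU) (_ : IsThetaField (Pt a c) F)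
          (_ : letI := thetaCurve_isElliptic hU F
            ((thetaCurve (Pt a c) F).galoisRepTorsion (ℓ : ℤ)).ker ≤ ψ.fieldRange.fixingSubgroup)
          (_ : 0 < (TateDivisorDatum.ofNFPointOver (Pt a c) {2, ℓ} F).logq)
          (Lmod : Type) (_ : Field Lmod) (_ : NumberField Lmod) (_ : Cor22.dmod (Pt a c) ≤ dMod Lmod) (_ : dMod Lmod ≤ 2)
          (V : Finset ℕ)
          (_ : ∀ q ∈ V, q.Prime ∧ (q ∣ 2 * 3 * 5 * ℓ ∨ (∃ v ∈ badPlacesAvoid (Pt a c) {2, ℓ}, residueChar (Pt a c).F v = q) ∨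
            ∃ u : HeightOneSpectrum (𝓞 K), residueChar K u = q ∧ 2 ≤ u.asIdeal.ramificationIdx ℤ))
          (_ : ∀ u : HeightOneSpectrum (𝓞 K), 2 ≤ u.asIdeal.ramificationIdx ℤ → residueChar K u ∈ V)
          (_ : ∀ w ∈ (TateDivisorDatum.ofNFPointOver (Pt a c) {2, ℓ} F).V, residueChar F w ∈ V)
          (DK : Finset (HeightOneSpectrum (𝓞 K))) (_ : ∀ u, differentDivisor K (Sum.inr u) ≠ 0 → u ∈ DK)
          (vol : ℕ → ℝ) (volArch : ℝ),
          (∀ p ∈ V, -(1 / (((ℓ : ℝ) - 1) / 2)) * |vol p| ≤ ((ℓ : ℝ) + 1) / 4 *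
            ((1 + 4 / (ℓ : ℝ)) *
                ((Module.finrank ℚ K : ℝ)⁻¹ *
                  ∑ u ∈ DK with residueChar K u = p, differentDivisor K (Sum.inr u) * logNorm K u)
              - 1 / 6 *
                ((Module.finrank ℚ F : ℝ)⁻¹ *
                  ∑ w ∈ (TateDivisorDatum.ofNFPointOver (Pt a c) {2, ℓ} F).V with residueChar F w = p,
                    (TateDivisorDatum.ofNFPointOver (Pt a c) {2, ℓ} F).tateDivisor (Sum.inr w) * logNorm F w)
              + 4 / (ℓ : ℝ) * Real.log p
              + 20 / 3 * ((2 ^ 12 * 3 ^ 3 * 5 * eMod Lmod : ℕ) : ℝ) *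
                (if p ≤ 2 ^ 12 * 3 ^ 3 * 5 * eMod Lmod * ℓ then Real.log p / p else 0))) ∧
          -(1 / (2 * (ℓ : ℝ)) * (TateDivisorDatum.ofNFPointOver (Pt a c) {2, ℓ} F).logq) ≤
            -(1 / (((ℓ : ℝ) - 1) / 2)) * (∑ p ∈ V, |vol p| + |volArch|) := by
  rintro ⟨F, _, _, _, K, _, _, _, _, _, _, ψ, hU, hF, hK, -, Lmod, _, _, -, hdmod, V, -, -, hbad, DK, -, vol, volArch,
    hStepV, hLower⟩
  have ha1 : 1 ≤ a := le_trans (by norm_num) ha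
  have hℓ5 : ℓ ≠ 5 := by omega
  -- `5 ∈ V^dst_ℚ`
  obtain ⟨w₅, hw₅, hres₅⟩ := exists_mem_V_residueChar_eq_five ha1 hc hℓ h7 F
  have h5V : 5 ∈ V := hres₅ ▸ hbad w₅ hw₅
  -- the three genuine numbers at `p₀ = 5`
  have hq5 := qFive_eq ha1 hc hℓ h7 F
  have hd5 := dFive_le ha1 hc ψ hU hF hℓ hℓ5 hK DK
  have hQ : (TateDivisorDatum.ofNFPointOver (Pt a c) {2, ℓ} F).logq ≤ 3 * a * Real.log 5 := by
    rw [TateDivisorDatum.logq_ofNFPointOver_eq_logQAvoid]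
    have h := logQAvoid_le ha1 hc {2, ℓ}
    have hc7 : (c : ℝ) * Real.log 7 ≤ a * Real.log 5 := by
      rw [← Real.log_pow, ← Real.log_pow]
      exact Real.log_le_log (by positivity) (by exact_mod_cast hlo)
    linarith
  -- the Mertens coefficient `e*_mod ≤ 2·2¹²3³5` and weight `ι₅ ≤ (log 5)/5`
  have hE : (((2 ^ 12 * 3 ^ 3 * 5 * eMod Lmod : ℕ) : ℝ)) ≤ 1105920 := by
    have h := (eMod_le_dMod (Lmod := Lmod)).trans hdmod
    have : ((eMod Lmod : ℕ) : ℝ) ≤ 2 := by exact_mod_cast h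
    push_cast; nlinarith
  have hι : ∀ N : ℕ, (0 : ℝ) ≤ (if 5 ≤ N then Real.log 5 / 5 else 0) ∧ (if 5 ≤ N then Real.log 5 / 5 else 0) ≤ Real.log 5 / 5 := by
    intro N
    have : 0 ≤ Real.log 5 / 5 := div_nonneg (Real.log_nonneg (by norm_num)) (by norm_num)
    split_ifs <;> exact ⟨by positivity, by linarith⟩
  refine not_exists_volumes_of_localExcess ℓ (by omega) V
    (fun p => (Module.finrank ℚ K : ℝ)⁻¹ * ∑ u ∈ DK with residueChar K u = p, differentDivisor K (Sum.inr u) * logNorm K u)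
    (fun p => (Module.finrank ℚ F : ℝ)⁻¹ *
      ∑ w ∈ (TateDivisorDatum.ofNFPointOver (Pt a c) {2, ℓ} F).V with residueChar F w = p,
        (TateDivisorDatum.ofNFPointOver (Pt a c) {2, ℓ} F).tateDivisor (Sum.inr w) * logNorm F w)
    ((2 ^ 12 * 3 ^ 3 * 5 * eMod Lmod : ℕ) : ℝ) _ (2 ^ 12 * 3 ^ 3 * 5 * eMod Lmod * ℓ) h5V ?_ ⟨vol, volArch, hStepV, hLower⟩
  have h5 : ((5 : ℕ) : ℝ) = 5 := by norm_num
  simp only [h5]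
  exact localExcess_arith (by exact_mod_cast h7) (by exact_mod_cast ha) hQ hq5.ge hd5 hE (hι _).1 (hι _).2

end SUnitResidual

/-! ## 3. HENCE the antecedent of `abc_of_genuineResidualSupport` is FALSE: that implication is VACUOUS -/

/-- `3·log(4·2¹²·3³·5·2) ≤ 10⁶` (room threshold of Lemma 6.7.8 vs `ξ_prm = 10⁶`). [folklore] -/
private theorem three_log_le_million : 3 * Real.log (4 * (2 ^ 12 * 3 ^ 3 * 5 * ((2 : ℕ) : ℝ))) ≤ 1000000 := by
  have h1 : Real.log (4 * (2 ^ 12 * 3 ^ 3 * 5 * ((2 : ℕ) : ℝ))) ≤ Real.log ((2 : ℝ) ^ 23) :=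
    Real.log_le_log (by positivity) (by norm_num)
  rw [Real.log_pow] at h1
  have h2 := Real.log_two_lt_d9
  push_cast at h1 ⊢
  nlinarith

/-- **THE ANTECEDENT OF `abc_of_genuineResidualSupport` (p464392 §4) IS FALSE** — the statement below is that hypothesis VERBATIM, negated.
Witness: `d = 2`, `P = P_{a,c}` an S-unit point with `a·log 5 > max(10¹², H_K)` (so `a ≥ 10⁸`), `7^c ≤ 5^a < 7^{c+1}` (so `P ∈ K_∞(7)`, the tree's `cbTwoDiscs`), and the prime
`ℓ` that Lemma 5.8.7 itself supplies at `P` (`exists_isLem587Prime` with `ξ_prm = 10⁶`, `isXiPrm_million`): `P ∈ U(Q̄)_{≤2}` (`P_mem_UP`,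
`[F_{a,c}:ℚ] = 2`), `ITDConditions` (`ℓ ≥ √(log q^∀) ≥ 10⁶ ≥ 7`; (P2) inside `IsLem587Prime`; (P5) `condP5_P`; (P6) by the tree's PROVED
(P4) ⟹ (P6) `Cor22.condP6_of_seven_le` above the height `H_K` of `K_∞(7)`), `AdmitsCore` (`admitsCore_P`), the Lemma-6.7.8 room
(`lem678Room_of_isLem587Prime`) — all hypotheses of the binder MET, and its `∃`-conclusion refuted by `genuineResidualSupport_unsat`. Hence
`abc_of_genuineResidualSupport` (and `abc_of_genuineResidual_reading3`) are VACUOUS implications: at GENUINE components the per-prime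
Step (v) residual with (6.11.1)'s `Σ|·|` convention cannot be what [J-IV] §6 hands over — the honest residual is the GLOBAL inequality (G)
(E-t50's `abc_of_globalInequality_nonneg`, E-cx-3 §C1). LOCATES; no side taken on [IUTchIII] Cor. 3.12 / [IUTchIV] Thm. 1.10 or on any
author; NOT an abc claim; typed ≠ proved ≠ endorsed. [claim: Joshi2024ATS4, status: disputed] -/
theorem not_genuineResidualSupport_antecedent :
    ¬ (∀ (d : ℕ), 0 < d → ∀ P ∈ UPle d, ∀ (ℓ : ℕ) (hℓ : ℓ.Prime) (h5 : 5 ≤ ℓ), IsLem587Prime d P ℓ → ITDConditions P ℓ →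
      AdmitsCore P → Real.log (4 * (2 ^ 12 * 3 ^ 3 * 5 * (d : ℝ)) * ℓ) ≤ 4 / 3 * ℓ →
        ∃ (F : Type) (_ : Field F) (_ : NumberField F) (_ : Algebra P.F F)
          (K : Type) (_ : Field K) (_ : NumberField K) (_ : Algebra F K) (_ : Algebra P.F K) (_ : IsScalarTower P.F F K)
          (_ : IsGalois F K) (ψ : K →ₐ[F] AlgebraicClosure F) (hU : P.InU) (_ : IsThetaField P F)
          (_ : letI := thetaCurve_isElliptic hU F
            ((thetaCurve P F).galoisRepTorsion (ℓ : ℤ)).ker ≤ ψ.fieldRange.fixingSubgroup)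
          (_ : 0 < (TateDivisorDatum.ofNFPointOver P {2, ℓ} F).logq)
          (Lmod : Type) (_ : Field Lmod) (_ : NumberField Lmod) (_ : Cor22.dmod P ≤ dMod Lmod) (_ : dMod Lmod ≤ d)
          (V : Finset ℕ)
          (_ : ∀ q ∈ V, q.Prime ∧ (q ∣ 2 * 3 * 5 * ℓ ∨ (∃ v ∈ badPlacesAvoid P {2, ℓ}, residueChar P.F v = q) ∨
            ∃ u : HeightOneSpectrum (𝓞 K), residueChar K u = q ∧ 2 ≤ u.asIdeal.ramificationIdx ℤ))
          (_ : ∀ u : HeightOneSpectrum (𝓞 K), 2 ≤ u.asIdeal.ramificationIdx ℤ → residueChar K u ∈ V)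
          (_ : ∀ w ∈ (TateDivisorDatum.ofNFPointOver P {2, ℓ} F).V, residueChar F w ∈ V)
          (DK : Finset (HeightOneSpectrum (𝓞 K))) (_ : ∀ u, differentDivisor K (Sum.inr u) ≠ 0 → u ∈ DK)
          (vol : ℕ → ℝ) (volArch : ℝ),
          (∀ p ∈ V, -(1 / (((ℓ : ℝ) - 1) / 2)) * |vol p| ≤ ((ℓ : ℝ) + 1) / 4 *
            ((1 + 4 / (ℓ : ℝ)) *
                ((Module.finrank ℚ K : ℝ)⁻¹ *
                  ∑ u ∈ DK with residueChar K u = p, differentDivisor K (Sum.inr u) * logNorm K u)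
              - 1 / 6 *
                ((Module.finrank ℚ F : ℝ)⁻¹ *
                  ∑ w ∈ (TateDivisorDatum.ofNFPointOver P {2, ℓ} F).V with residueChar F w = p,
                    (TateDivisorDatum.ofNFPointOver P {2, ℓ} F).tateDivisor (Sum.inr w) * logNorm F w)
              + 4 / (ℓ : ℝ) * Real.log p
              + 20 / 3 * ((2 ^ 12 * 3 ^ 3 * 5 * eMod Lmod : ℕ) : ℝ) *
                (if p ≤ 2 ^ 12 * 3 ^ 3 * 5 * eMod Lmod * ℓ then Real.log p / p else 0))) ∧
          -(1 / (2 * (ℓ : ℝ)) * (TateDivisorDatum.ofNFPointOver P {2, ℓ} F).logq) ≤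
            -(1 / (((ℓ : ℝ) - 1) / 2)) * (∑ p ∈ V, |vol p| + |volArch|)) := by
  intro h
  -- BY NAME: `h` is literally the hypothesis of p464392's `abc_of_genuineResidualSupport`
  have _hvacuous : ABC := abc_of_genuineResidualSupport h
  -- the compactly bounded set `K_∞(7)` and the height above which (P4) ⟹ (P6) is in force on it
  obtain ⟨HK, hHK⟩ := condP6_of_seven_le (cbTwoDiscs 7 (by norm_num))
  have hlog5 : 0 < Real.log 5 := Real.log_pos (by norm_num)
  -- the exponents: `a·log 5 > max(10¹², H_K)` (so `a ≥ 10⁸`); `c := ⌊log₇ 5^a⌋`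
  obtain ⟨a, ha⟩ := exists_nat_gt (max (10 ^ 12 : ℝ) HK / Real.log 5)
  rw [div_lt_iff₀ hlog5] at ha
  have ha12 : (10 : ℝ) ^ 12 ≤ a * Real.log 5 := (le_max_left _ _).trans ha.le
  have hHKa : HK < a * Real.log 5 := lt_of_le_of_lt (le_max_right _ _) ha
  have haR : (10 : ℝ) ^ 8 ≤ a := by
    have : Real.log 5 ≤ 5 - 1 := Real.log_le_sub_one_of_pos (by norm_num)
    nlinarith
  have ha8 : 10 ^ 8 ≤ a := by exact_mod_cast haR
  have ha1 : 1 ≤ a := le_trans (by norm_num) ha8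
  set c : ℕ := Nat.log 7 (5 ^ a) with hcdef
  have hlo : 7 ^ c ≤ 5 ^ a := Nat.pow_log_le_self 7 (pow_ne_zero a (by norm_num))
  have hhi : 5 ^ a < 7 ^ (c + 1) := Nat.lt_pow_succ_log_self (by norm_num) (5 ^ a)
  have hc1 : 1 ≤ c := Nat.log_pos (by norm_num)
    (calc 7 ≤ 5 ^ 2 := by norm_num
      _ ≤ 5 ^ a := Nat.pow_le_pow_right (by norm_num) (le_trans (by norm_num) ha8))
  -- the point and its admissibility data
  have hP : Pt a c ∈ UP := P_mem_UP ha1 hc1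
  have hdeg : (Pt a c).degree ≤ 2 := (finrank_F a c).le
  have hPle : Pt a c ∈ UPle 2 := ⟨hP, hdeg⟩
  have hmem : Pt a c ∈ (cbTwoDiscs 7 (by norm_num)).toSet :=
    P_mem_cbTwoDiscs (a := a) (c := c) (by norm_num) (by exact_mod_cast hlo) (by
      have : ((5 ^ a : ℕ) : ℝ) ≤ ((7 ^ (c + 1) : ℕ) : ℝ) := by exact_mod_cast hhi.le
      push_cast at this; rw [pow_succ] at this; linarith)
  have hQ : (a : ℝ) * Real.log 5 ≤ logQForall (Pt a c) := le_logQForall_P ha1 hc1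
  have hsqrt : (1000000 : ℝ) ≤ Real.sqrt (logQForall (Pt a c)) :=
    Real.le_sqrt_of_sq_le (by nlinarith)
  -- the prime of Lemma 5.8.7 at the point, and the conditions of the binder at it
  obtain ⟨ℓ, hℓP⟩ := exists_isLem587Prime (Pt a c) hdeg isXiPrm_million hsqrt
  have hℓ : ℓ.Prime := hℓP.1
  have h7 : 7 ≤ ℓ := by
    have : (7 : ℝ) ≤ ℓ := le_trans (by linarith) hℓP.2.1
    exact_mod_cast this
  have hITD : ITDConditions (Pt a c) ℓ :=
    ⟨h7, hℓP.2.2.2.1, condP5_P ha1 hc1 hℓ (by omega),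
      hHK (Pt a c) hmem hP ℓ hℓ h7 hℓP.2.2.2.1 (condP5_P ha1 hc1 hℓ (by omega)) (lt_of_lt_of_le hHKa hQ)⟩
  have hroom : Real.log (4 * (2 ^ 12 * 3 ^ 3 * 5 * ((2 : ℕ) : ℝ)) * ℓ) ≤ 4 / 3 * ℓ :=
    lem678Room_of_isLem587Prime hℓP (C := 2 ^ 12 * 3 ^ 3 * 5 * ((2 : ℕ) : ℝ)) (by positivity)
      (three_log_le_million.trans hsqrt)
  exact SUnitResidual.genuineResidualSupport_unsat ha8 hc1 hlo hℓ h7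
    (h 2 (by norm_num) (Pt a c) hPle ℓ hℓ (le_trans (by norm_num) h7) hℓP hITD (admitsCore_P ha1 hc1) hroom)

end Summit.ABC.IUTFork.Joshi.ATS4

end
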